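import Literature.Probability.RandomPlanarGeometry.HexSAWArmchairThirdOrderLower
import Literature.Probability.RandomPlanarGeometry.HexSAWArmchairThirdOrderUpper
import Literature.Probability.RandomPlanarGeometry.HexSAWSurfaceThirdOrder
import HarnessLib

/-!
# Beaton's ROTATED (armchair) honeycomb surface: the third coefficient is EXACTLY `1` —
# `y²(β_rot(y)² − y − 1/y) → 1`, i.e. `β_rot(y)² = y + 1/y + 1/y² + o(y⁻²)` (and the same for `μ_rot`)

Topic `Literature/Probability/RandomPlanarGeometry` (lane «pcv-sawmu», car «ARM-THIRD-ORDER-EXACT», a-p6 g15): the two-sided packaging of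
«ARM-THIRD-ORDER-LOWER» (`1 − 68903/y ≤ y²(β_rot² − y − 1/y)`, `y ≥ 300`; three-seed renewal) and «ARM-THIRD-ORDER-UPPER»
(`y²(β_rot² − y − 1/y) ≤ 1 + 211595/√y`, `y ≥ 10⁴`; three-step-alive arches); and, with «WALL-THIRD-ORDER-UPPER»'s
`y²(β² − y − 1/y) → 1` for the ZIG-ZAG wall (`HexSAWSurfaceThirdOrder.lean`), the comparison `y²(β(y)² − β_rot(y)²) → 0`: the two
honeycomb surface orientations have the SAME adsorbed-phase expansion through third order.

Sources.  N. R. Beaton, CMP 326 (2014) = arXiv:1210.0274v3, §3 (pp. 10–11), §3.1 (p. 12); N. Madras, G. Slade, *The Self-Avoiding Walk*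
(1993), §1.2, (1.2.17).
-/

noncomputable section

open Filter
open _root_.Topology

namespace Literature.Probability.RandomPlanarGeometry.SAW.HexBW.Arm

variable {y : ℝ}

/-- ★★★★ **The third-order WINDOW** (`y ≥ 10⁴`): `y²(β_rot(y)² − y − 1/y) ∈ [1 − 68903/y, 1 + 211595/√y]`.
[cite: Beaton2014RotatedHoneycomb, §3.1 (arXiv v3 p. 12); MadrasSlade1993, §1.2, (1.2.17)] -/
theorem sq_mul_armRate_sq_sub_sub_mem_Icc (hy : 10000 ≤ y) :
    y ^ 2 * (armRate y ^ 2 - y - 1 / y) ∈ Set.Icc (1 - 68903 / y) (1 + 211595 / Real.sqrt y) :=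
  ⟨sq_mul_armRate_sq_sub_sub_ge (by linarith), sq_mul_armRate_sq_sub_sub_le hy⟩

/-- ★★★★ **`y²(β_rot(y)² − y − 1/y) → 1`**: the third coefficient of the armchair adsorbed-phase expansion is exactly `1`
(`β_rot(y)² = y + 1/y + 1/y² + o(y⁻²)`), as for the zig-zag wall. [cite: Beaton2014RotatedHoneycomb, §3.1 (arXiv v3 p. 12)] -/
theorem tendsto_sq_mul_armRate_sq_sub_sub :
    Tendsto (fun y : ℝ => y ^ 2 * (armRate y ^ 2 - y - 1 / y)) atTop (𝓝 1) := by
  have hlo : Tendsto (fun y : ℝ => 1 - (68903 : ℝ) / y) atTop (𝓝 1) := by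
    have h := (tendsto_const_nhds (x := (68903 : ℝ))).div_atTop tendsto_id
    simpa using (tendsto_const_nhds (x := (1 : ℝ))).sub h
  have hhi : Tendsto (fun y : ℝ => 1 + (211595 : ℝ) / Real.sqrt y) atTop (𝓝 1) := by
    have h := (tendsto_const_nhds (x := (211595 : ℝ))).div_atTop Real.tendsto_sqrt_atTop
    simpa using (tendsto_const_nhds (x := (1 : ℝ))).add h
  refine tendsto_of_tendsto_of_tendsto_of_le_of_le' hlo hhi ?_ ?_
  · filter_upwards [eventually_ge_atTop (300 : ℝ)] with y hy using sq_mul_armRate_sq_sub_sub_ge hy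
  · filter_upwards [eventually_ge_atTop (10000 : ℝ)] with y hy using sq_mul_armRate_sq_sub_sub_le hy

/-- **`β_rot(y)² − y − 1/y ~ 1/y²`**: `(β_rot² − y − 1/y) / (1/y²) → 1`. [cite: Beaton2014RotatedHoneycomb, §3.1 (arXiv v3 p. 12)] -/
theorem tendsto_armRate_sq_sub_sub_div :
    Tendsto (fun y : ℝ => (armRate y ^ 2 - y - 1 / y) / (1 / y ^ 2)) atTop (𝓝 1) := by
  refine tendsto_sq_mul_armRate_sq_sub_sub.congr' ?_
  filter_upwards [eventually_gt_atTop (0 : ℝ)] with y hy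
  field_simp

/-- ★★★ **Zig-zag versus armchair through THIRD order**: `y² (β(y)² − β_rot(y)²) → 0` — the Duminil-Copin–Smirnov (zig-zag) and Beaton
(armchair) honeycomb surface growth rates agree to `o(y⁻²)`: both are `y + 1/y + 1/y² + o(y⁻²)`.
[cite: Beaton2014RotatedHoneycomb, §3 (arXiv v3 pp. 10–11); BeatonBousquetMelouDeGierDuminilCopinGuttmann2014, Theorem 1 (CMP 326 p. 729)] -/
theorem tendsto_sq_mul_wallRate_sq_sub_armRate_sq :
    Tendsto (fun y : ℝ => y ^ 2 * (Wall.wallRate y ^ 2 - armRate y ^ 2)) atTop (𝓝 0) := by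
  have h := Wall.tendsto_sq_mul_wallRate_sq_sub_sub.sub tendsto_sq_mul_armRate_sq_sub_sub
  rw [sub_self] at h
  refine h.congr' ?_
  filter_upwards with y
  ring

end Literature.Probability.RandomPlanarGeometry.SAW.HexBW.Arm

namespace Literature.Probability.RandomPlanarGeometry.SAW.HV

open Literature.Probability.RandomPlanarGeometry.SAW.HexBW.Arm

/-- ★★★★ **`y²(μ_rot(y)² − y − 1/y) → 1`** for Beaton's rotated-honeycomb surface growth rate: `μ_rot(y)² = y + 1/y + 1/y² + o(y⁻²)`.
[cite: Beaton2014RotatedHoneycomb, Proposition 7 (arXiv v3 p. 11), §3.1 (p. 12)] -/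
theorem tendsto_sq_mul_rotSurfaceMu_sq_sub_sub :
    Tendsto (fun y : ℝ => y ^ 2 * (rotSurfaceMu y ^ 2 - y - 1 / y)) atTop (𝓝 1) := by
  refine tendsto_sq_mul_armRate_sq_sub_sub.congr' ?_
  filter_upwards [eventually_ge_atTop (4 : ℝ)] with y hy
  rw [rotSurfaceMu_eq_armRate_of_four_le hy]

/-- The third-order window for `μ_rot` (`y ≥ 10⁴`). [cite: Beaton2014RotatedHoneycomb, Proposition 7 (arXiv v3 p. 11), §3.1 (p. 12)] -/
theorem sq_mul_rotSurfaceMu_sq_sub_sub_mem_Icc {y : ℝ} (hy : 10000 ≤ y) :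
    y ^ 2 * (rotSurfaceMu y ^ 2 - y - 1 / y) ∈ Set.Icc (1 - 68903 / y) (1 + 211595 / Real.sqrt y) := by
  rw [rotSurfaceMu_eq_armRate_of_four_le (by linarith)]; exact sq_mul_armRate_sq_sub_sub_mem_Icc hy

/-- ★★★ **`y²(μ(y)² − μ_rot(y)²) → 0`**: the zig-zag (`HV.surfaceMu`) and armchair (`HV.rotSurfaceMu`) honeycomb surface growth rates agree
through third order. [cite: Beaton2014RotatedHoneycomb, §3 (arXiv v3 pp. 10–11), Proposition 7 (p. 11)] -/
theorem tendsto_sq_mul_surfaceMu_sq_sub_rotSurfaceMu_sq :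
    Tendsto (fun y : ℝ => y ^ 2 * (surfaceMu y ^ 2 - rotSurfaceMu y ^ 2)) atTop (𝓝 0) := by
  have h := HexBW.Wall.tendsto_sq_mul_surfaceMu_sq_sub_sub.sub tendsto_sq_mul_rotSurfaceMu_sq_sub_sub
  rw [sub_self] at h
  refine h.congr' ?_
  filter_upwards with y
  ring

end Literature.Probability.RandomPlanarGeometry.SAW.HV
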